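import Literature.Probability.Percolation.SlabCircuitGlueData
import HarnessLib

/-!
# Newman–Tassion–Wu 2017, Theorem 3.8 / CPAM Theorem 3.10 — open circuits and the NEEDLE: "the local
# modification does not create any new circuit"

Topic: `Literature/Probability/Percolation`.  Second file of the circuit gluing layer (data:
`SlabCircuitGlueData.lean`); no definitions.  The vertical surgery of NTW's circuit gluing lemma opens a
"needle" — a far vertex `u`, then the vertical segment `v, …, g` of one column, ending at a vertex `g` of
the minimal circuit — and closes every other pair at the inner vertices of the needle.  NTW (CPAM p. 15):
"Observe that the local modification above does not create any new circuit in `A_{m,n}`.  Otherwise, the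
new circuit would contain all the vertical edges between `u` and `v`, which would imply some site on
`Γ₁(ω)` is connected (through `κ_z`) to `Γ₂(ω)`".  This file proves the combinatorics behind that
sentence, for an abstract needle (a list without duplicates whose inner vertices have all their open
pairs on it):

* `IsOpenCircuit.reverse`, `.rotate`, `.of_consecutive`, `.three_le_length_of_surrounds`,
  `.exists_rotate_pair` — bookkeeping on the tree's open circuits (`SlabAnnulusCircuits.lean`).
* `needle_forward` — an open self-avoiding chain entering the needle follows it to its end (or stops
  inside it).
* `needle_circuit` — an open circuit with at least three vertices through a needle pair exhibits an open
  path, made of pairs that are not needle pairs, between the two ends of the needle.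

## Sources

* C. M. Newman, V. Tassion, W. Wu, *Critical percolation and the minimal spanning tree in slabs*,
  Comm. Pure Appl. Math. 70 (2017) 2084–2120 = arXiv:1512.09107: §3.2, proof of Theorem 3.8 (arXiv)
  = Theorem 3.10 (CPAM), (3.5)–(3.8), pp. 14–16 [NewmanTassionWu2017].
-/

noncomputable section

namespace Literature.Probability.Percolation

open MeasureTheory LatticeModels SimpleGraph

namespace NTW17

/-! ## Generic facts on open circuits -/

namespace IsOpenCircuit

variable {k : ℕ} {ω : BondConfig (slab 3 k)} {A : Set (slab 3 k)} {l : List (slab 3 k)}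

/-- The reversal of an open circuit is an open circuit. [cite: NewmanTassionWu2017, §3.2 (circuits identified up to reversal)] -/
theorem reverse (hl : IsOpenCircuit k ω A l) : IsOpenCircuit k ω A l.reverse := by
  refine ⟨List.nodup_reverse.2 hl.nodup, ?_, fun x hx => hl.subset x (List.mem_reverse.1 hx), by simpa using hl.ne_nil,
    fun hne => ?_⟩
  · rw [List.isChain_reverse]
    exact hl.chain.imp fun a b h => ⟨by rw [Sym2.eq_swap]; exact h.1, h.2.symm⟩
  · have hne' : l ≠ [] := by simpa using hne
    rw [List.getLast_reverse, List.head_reverse]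
    obtain ⟨h1, h2⟩ := hl.closing hne'
    exact ⟨by rw [Sym2.eq_swap]; exact h1, h2.symm⟩

/-- A rotation of an open circuit is an open circuit. [cite: NewmanTassionWu2017, §3.2 (circuits identified up to cyclic permutations)] -/
theorem rotate (hl : IsOpenCircuit k ω A l) {l₁ l₂ : List (slab 3 k)} (h : l = l₁ ++ l₂) :
    IsOpenCircuit k ω A (l₂ ++ l₁) := by
  by_cases h1n : l₁ = []
  · subst h1n; rw [List.nil_append] at h; rw [List.append_nil, ← h]; exact hl
  by_cases h2n : l₂ = []
  · subst h2n; rw [List.append_nil] at h; rw [List.nil_append, ← h]; exact hl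
  have hne : l ≠ [] := hl.ne_nil
  have hch := hl.chain
  rw [h, List.isChain_append] at hch
  obtain ⟨hc₁, hc₂, hj⟩ := hch
  have hlast : l.getLast hne = l₂.getLast h2n := by
    simp only [h, List.getLast_append_of_ne_nil _ h2n]
  have hhead : l.head hne = l₁.head h1n := by
    simp only [h, List.head_append_of_ne_nil h1n]
  obtain ⟨hcl, hcl'⟩ := hl.closing hne
  rw [hlast, hhead] at hcl hcl'
  refine ⟨?_, ?_, ?_, by simp [h2n], fun hne' => ?_⟩
  · have := hl.nodup; rw [h] at this
    exact (List.perm_append_comm.nodup_iff).1 this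
  · rw [List.isChain_append]
    refine ⟨hc₂, hc₁, fun x hx z hz => ?_⟩
    rw [List.getLast?_eq_some_getLast h2n, Option.mem_def, Option.some.injEq] at hx
    rw [List.head?_eq_some_head h1n, Option.mem_def, Option.some.injEq] at hz
    subst hx hz
    exact ⟨hcl, hcl'⟩
  · intro x hx; rcases List.mem_append.1 hx with hx | hx
    · exact hl.subset x (h ▸ List.mem_append_right _ hx)
    · exact hl.subset x (h ▸ List.mem_append_left _ hx)
  · rw [List.getLast_append_of_ne_nil _ h1n, List.head_append_of_ne_nil h2n]
    have := hj (l₁.getLast h1n) (by rw [List.getLast?_eq_some_getLast h1n]; rfl) (l₂.head h2n)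
      (by rw [List.head?_eq_some_head h2n]; rfl)
    exact this

/-- An open circuit of `ω'` all of whose consecutive pairs (and the closing pair) are `ω`-open is an
open circuit of `ω`. [cite: NewmanTassionWu2017, §3.2 (circuits)] -/
theorem of_consecutive {ω' : BondConfig (slab 3 k)} (hl : IsOpenCircuit k ω' A l)
    (h : ∀ (a b : slab 3 k) (l₁ l₂ : List (slab 3 k)), l = l₁ ++ a :: b :: l₂ → s(a, b) ∈ ω)
    (hc : ∀ hne : l ≠ [], s(l.getLast hne, l.head hne) ∈ ω) : IsOpenCircuit k ω A l := by
  refine ⟨hl.nodup, ?_, hl.subset, hl.ne_nil, fun hne => ⟨hc hne, (hl.closing hne).2⟩⟩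
  have hne := List.isChain_iff_forall_rel_of_append_cons_cons.1 hl.chain
  rw [List.isChain_iff_forall_rel_of_append_cons_cons]
  intro a b l₁ l₂ heq
  exact ⟨h a b l₁ l₂ heq, (hne heq).2⟩

/-- A surrounding vertex list has at least three vertices (one- and two-vertex sequences have winding
number zero). [cite: NewmanTassionWu2017, §3.2 (circuits surrounding the origin)] -/
theorem three_le_length_of_surrounds {c : ℤ × ℤ} (hs : Surrounds k c l) : 3 ≤ l.length := by
  by_contra h
  apply hs
  have hself : ∀ a : Site 2, stepWinding (ts c) a a = 0 := fun a => by unfold stepWinding; simp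
  match l, h with
  | [], _ => simp [seqWinding]
  | [a], _ => simp [seqWinding, hself]
  | [a, b], _ => simp [seqWinding, stepWinding_antisymm (ts c) (proj k a) (proj k b)]
  | _ :: _ :: _ :: t, h => exact absurd h (by simp)

end IsOpenCircuit

/-! ## The needle: a lattice path whose interior vertices have all their open edges on it -/

section Needle

variable {k : ℕ} {ω' : BondConfig (slab 3 k)}

/-- In a list without duplicates the predecessor of an element is determined. [folklore] -/
private theorem eq_of_cons_cons_eq_append_pred {α : Type*} {L : List α} {x y₀ y : α} {l₀ r l₁ l₂ : List α}
    (hnd : L.Nodup) (h0 : L = l₀ ++ y₀ :: x :: r) (h : L = l₁ ++ y :: x :: l₂) : y = y₀ := by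
  have hr : L.reverse = r.reverse ++ x :: y₀ :: l₀.reverse := by rw [h0]; simp
  have hr' : L.reverse = l₂.reverse ++ x :: y :: l₁.reverse := by rw [h]; simp
  exact eq_of_cons_cons_eq_append (List.nodup_reverse.2 hnd) hr hr'

/-- **Continuation along the needle.**  Let `Ndl` be a list without duplicates ("the needle") such that
every `ω'`-open pair at a vertex of `Ndl` other than its two ends joins it to one of its two
neighbours on `Ndl`.  If an `ω'`-open self-avoiding chain contains two consecutive vertices `a, b`
that are consecutive on the needle (in this order), then after `b` the chain follows the needle: either
up to its end, or until the chain stops.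
[cite: NewmanTassionWu2017, §3.2 (CPAM Theorem 3.10: "the new circuit would contain all the vertical edges between u and v")] -/
theorem needle_forward {Ndl : List (slab 3 k)} (hnd : Ndl.Nodup)
    (H : ∀ (x z : slab 3 k) (m₁ m₂ : List (slab 3 k)), Ndl = m₁ ++ x :: m₂ → m₁ ≠ [] → m₂ ≠ [] →
      s(x, z) ∈ ω' → (∃ l₁ l₂, Ndl = l₁ ++ x :: z :: l₂) ∨ (∃ l₁ l₂, Ndl = l₁ ++ z :: x :: l₂)) :
    ∀ (N₂ N₁ P T : List (slab 3 k)) (a b : slab 3 k), Ndl = N₁ ++ a :: b :: N₂ →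
      (P ++ a :: b :: T).Nodup → (P ++ a :: b :: T).IsChain (fun x z => s(x, z) ∈ ω' ∧ x ≠ z) →
      N₂ <+: T ∨ (T <+: N₂ ∧ T ≠ N₂) := by
  intro N₂
  induction N₂ with
  | nil => intro N₁ P T a b _ _ _; exact Or.inl (List.nil_prefix)
  | cons b' N₂' ih =>
    intro N₁ P T a b hN hnd' hch
    cases T with
    | nil => exact Or.inr ⟨List.nil_prefix, by simp⟩
    | cons t T'' =>
      -- the pair `(b, t)` is open, `b` is an interior vertex of the needle
      have hsplit : P ++ a :: b :: t :: T'' = (P ++ [a]) ++ b :: t :: T'' := by simp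
      have hbt : s(b, t) ∈ ω' := ((List.isChain_iff_forall_rel_of_append_cons_cons.1 hch) hsplit).1
      have hN' : Ndl = (N₁ ++ [a]) ++ b :: b' :: N₂' := by rw [hN]; simp
      have hadj := H b t (N₁ ++ [a]) (b' :: N₂') hN' (by simp) (by simp) hbt
      have ht : t = b' := by
        rcases hadj with ⟨l₁, l₂, h1⟩ | ⟨l₁, l₂, h1⟩
        · exact eq_of_cons_cons_eq_append hnd hN' h1
        · -- `t` would be the predecessor `a` of `b`, which occurs earlier in the chain
          have hta : t = a := eq_of_cons_cons_eq_append_pred hnd (l₀ := N₁) (r := b' :: N₂') hN h1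
          exfalso
          have hnd2 : (P ++ a :: b :: t :: T'').Nodup := hnd'
          rw [hta, List.nodup_append] at hnd2
          have h2 := hnd2.2.1
          simp at h2
      subst ht
      have := ih (N₁ ++ [a]) (P ++ [a]) T'' b t hN' (by simpa using hnd') (by simpa using hch)
      rcases this with h1 | ⟨h1, h2⟩
      · exact Or.inl (List.cons_prefix_cons.2 ⟨rfl, h1⟩)
      · refine Or.inr ⟨List.cons_prefix_cons.2 ⟨rfl, h1⟩, fun h3 => h2 ?_⟩
        exact (List.cons.inj h3).2

end Needle

/-! ## Rotating a circuit to a given consecutive pair -/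

namespace IsOpenCircuit

variable {k : ℕ} {ω : BondConfig (slab 3 k)} {A : Set (slab 3 k)} {l : List (slab 3 k)}

/-- If `x, z` are cyclically consecutive on an open circuit (a consecutive pair of the list, or the
closing pair `(last, head)`), some rotation of the circuit starts with `x, z`.
[cite: NewmanTassionWu2017, §3.2 (circuits up to cyclic permutation)] -/
theorem exists_rotate_pair (hl : IsOpenCircuit k ω A l) {x z : slab 3 k}
    (h : (∃ l₁ l₂, l = l₁ ++ x :: z :: l₂) ∨ (∃ hne : l ≠ [], l.getLast hne = x ∧ l.head hne = z)) :
    ∃ T, IsOpenCircuit k ω A (x :: z :: T) ∧ (x :: z :: T).length = l.length := by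
  rcases h with ⟨l₁, l₂, rfl⟩ | ⟨hne, hx, hz⟩
  · exact ⟨l₂ ++ l₁, by simpa using hl.rotate (l₁ := l₁) (l₂ := x :: z :: l₂) rfl, by simp; omega⟩
  · have h1 : l = l.dropLast ++ [x] := by rw [← hx]; exact (List.dropLast_append_getLast hne).symm
    have hrot := hl.rotate h1
    -- `l.dropLast` starts with `z` (the circuit has at least two vertices since `last ≠ head`)
    have hne2 : l.dropLast ≠ [] := by
      intro h0
      rw [h0, List.nil_append] at h1
      have := (hl.closing hne).2
      rw [hx, hz] at this
      apply this
      have hl1 : l = [x] := h1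
      subst hl1
      simpa using hz
    obtain ⟨w, T, hw⟩ := List.exists_cons_of_ne_nil hne2
    have hwz : w = z := by
      have h2 : l.head? = some z := by rw [← hz]; exact List.head?_eq_some_head hne
      have h3 : l.head? = some w := by rw [h1, hw]; simp
      rw [h2] at h3; exact (Option.some.inj h3).symm
    subst hwz
    refine ⟨T, by simpa [hw] using hrot, ?_⟩
    have := congrArg List.length h1
    rw [hw] at this; simp at this ⊢; omega

end IsOpenCircuit


/-! ## A circuit through the needle yields an old connection between the two ends of the needle -/

section NeedleCircuit

variable {k : ℕ} {ω ω' : BondConfig (slab 3 k)} {A : Set (slab 3 k)} {Ndl : List (slab 3 k)}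

/-- Elements of a list without duplicates written `N₁ ++ p :: M` : `p ∉ M` and `p ∉ N₁`. [folklore] -/
private theorem not_mem_of_nodup_split {α : Type*} {L N₁ M : List α} {p : α} (hnd : L.Nodup)
    (h : L = N₁ ++ p :: M) : p ∉ M ∧ p ∉ N₁ := by
  rw [h] at hnd
  rw [List.nodup_append] at hnd
  obtain ⟨-, h2, h3⟩ := hnd
  exact ⟨(List.nodup_cons.1 h2).1, fun hp => h3 p hp p (by simp) rfl⟩

/-- In `rest ++ [p]` without duplicates, the first vertex of any consecutive pair lies in `rest`. [folklore] -/
private theorem mem_of_split_snoc {α : Type*} {rest l₁ l₂ : List α} {p a b : α} (hnd : (rest ++ [p]).Nodup)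
    (h : rest ++ [p] = l₁ ++ a :: b :: l₂) : a ∈ rest := by
  have ha : a ∈ rest ++ [p] := by rw [h]; simp
  rcases List.mem_append.1 ha with ha | ha
  · exact ha
  · exfalso
    simp only [List.mem_singleton] at ha
    subst ha
    have hlast : (l₁ ++ a :: b :: l₂).getLast (by simp) = a := by
      rw [List.getLast_congr _ (by simp) h.symm]; simp
    rw [List.getLast_append_of_ne_nil _ (List.cons_ne_nil _ _), List.getLast_cons (List.cons_ne_nil b l₂)] at hlast
    have hmem : a ∈ b :: l₂ := hlast ▸ List.getLast_mem _
    rw [h, List.nodup_append] at hnd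
    exact (List.nodup_cons.1 hnd.2.1).1 hmem

/-- In a list of length `≥ 3` without duplicates, the last and the first element are not consecutive. [folklore] -/
private theorem not_mem_edgesOf_last_head {α : Type*} {L : List α} (hnd : L.Nodup) (h3 : 3 ≤ L.length)
    (hne : L ≠ []) : s(L.getLast hne, L.head hne) ∉ edgesOf L := by
  rintro ⟨a, b, l₁, l₂, hL, he⟩
  have hnd' := hnd
  rw [hL, List.nodup_append] at hnd'
  obtain ⟨hn1, hn2, hn3⟩ := hnd'
  have hab : a ≠ b := fun h => (List.nodup_cons.1 hn2).1 (by simp [h])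
  rcases Sym2.eq_iff.1 he with ⟨h1, h2⟩ | ⟨h1, h2⟩
  · -- `last = a`, `head = b`
    cases l₁ with
    | nil =>
      have : L.head hne = a := by simp [hL]
      exact hab (this.symm.trans h2)
    | cons c l₁' =>
      have hc : L.head hne = c := by simp [hL]
      rw [hc] at h2
      subst h2
      exact hn3 _ List.mem_cons_self _ (by simp) rfl
  · -- `last = b`, `head = a`
    cases l₁ with
    | cons c l₁' =>
      have hc : L.head hne = c := by simp [hL]
      rw [hc] at h2
      subst h2
      exact hn3 _ List.mem_cons_self _ (by simp) rfl
    | nil =>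
      simp only [List.nil_append] at hL
      cases l₂ with
      | nil => rw [hL] at h3; simp at h3
      | cons d l₂' =>
        have hl : L.getLast hne = (d :: l₂').getLast (List.cons_ne_nil _ _) := by
          rw [List.getLast_congr hne (by simp) hL]; simp
        rw [hl] at h1
        have hmem : b ∈ d :: l₂' := h1 ▸ List.getLast_mem _
        exact (List.nodup_cons.1 (List.nodup_cons.1 hn2).2).1 hmem

/-- **NTW: "the local modification does not create any new circuit" — quantitative form.**  Let the
needle `Ndl` (no duplicates) have the property that every `ω'`-open pair at an inner vertex of the
needle is a pair of consecutive needle vertices, and let every `ω'`-open pair that is not a pair of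
consecutive needle vertices be `ω`-open.  If an `ω'`-open circuit inside `A` with at least three
vertices passes consecutively through two consecutive needle vertices `p, q`, then the last vertex of
the needle is joined to its first vertex by an `ω`-open path inside `A`.
[cite: NewmanTassionWu2017, §3.2 (CPAM Theorem 3.10: "Otherwise, the new circuit would contain all the vertical edges between u and v, which would imply some site on Γ₁(ω) is connected (through κ_z) to Γ₂(ω)")] -/
theorem needle_circuit (hnd : Ndl.Nodup) (hne : Ndl ≠ [])
    (H : ∀ (x z : slab 3 k) (m₁ m₂ : List (slab 3 k)), Ndl = m₁ ++ x :: m₂ → m₁ ≠ [] → m₂ ≠ [] →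
      s(x, z) ∈ ω' → (∃ l₁ l₂, Ndl = l₁ ++ x :: z :: l₂) ∨ (∃ l₁ l₂, Ndl = l₁ ++ z :: x :: l₂))
    (Hω : ∀ e ∈ ω', e ∉ edgesOf Ndl → e ∈ ω) :
    ∀ (n : ℕ) (N₁ : List (slab 3 k)), N₁.length ≤ n → ∀ (p q : slab 3 k) (N₂ T : List (slab 3 k)),
      Ndl = N₁ ++ p :: q :: N₂ → IsOpenCircuit k ω' A (p :: q :: T) → 3 ≤ (p :: q :: T).length →
      ω ∈ openConnIn A (Ndl.getLast hne) (Ndl.head hne) := by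
  -- the reduction step, valid for every `N₁`
  have step : ∀ (N₁ : List (slab 3 k)) (p q : slab 3 k) (N₂ T : List (slab 3 k)),
      Ndl = N₁ ++ p :: q :: N₂ → IsOpenCircuit k ω' A (p :: q :: T) → 3 ≤ (p :: q :: T).length →
      ω ∈ openConnIn A (Ndl.getLast hne) (Ndl.head hne) ∨
        ∃ (hN₁ : N₁ ≠ []) (T' : List (slab 3 k)), IsOpenCircuit k ω' A (N₁.getLast hN₁ :: p :: T') ∧
          3 ≤ (N₁.getLast hN₁ :: p :: T').length ∧ Ndl = N₁.dropLast ++ N₁.getLast hN₁ :: p :: (q :: N₂) := by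
    intro N₁ p q N₂ T hN hΔ h3
    have hΔnd := hΔ.nodup
    have hTne : T ≠ [] := by rintro rfl; simp at h3
    have hqT : q ∉ T := (List.nodup_cons.1 (List.nodup_cons.1 hΔnd).2).1
    have hpqT : p ∉ q :: T := (List.nodup_cons.1 hΔnd).1
    rcases needle_forward hnd H N₂ N₁ [] T p q hN (by simpa using hΔnd) (by simpa using hΔ.chain) with h1 | ⟨h1, h2⟩
    · -- (i) the circuit follows the needle to its end
      obtain ⟨rest, hT⟩ := h1
      by_cases hN₁ : N₁ = []
      · -- the circuit starts at the first vertex of the needle: the part after the needle is the path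
        left
        subst hN₁
        rw [List.nil_append] at hN
        have hhead : Ndl.head hne = p := by simp [hN]
        set g' := (q :: N₂).getLast (List.cons_ne_nil q N₂) with hg'
        have hlast : Ndl.getLast hne = g' := by
          simp only [hN, List.getLast_cons (List.cons_ne_nil q N₂), hg']
        rw [hhead, hlast]
        -- the chain `g' :: rest` followed by the closing pair to `p`
        have hΔeq : p :: q :: T = (p :: (q :: N₂).dropLast) ++ g' :: rest := by
          rw [← hT]
          have : q :: N₂ = (q :: N₂).dropLast ++ [g'] := (List.dropLast_append_getLast (List.cons_ne_nil q N₂)).symm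
          calc p :: q :: (N₂ ++ rest) = p :: ((q :: N₂) ++ rest) := by simp
            _ = p :: (((q :: N₂).dropLast ++ [g']) ++ rest) := by rw [← this]
            _ = (p :: (q :: N₂).dropLast) ++ g' :: rest := by simp
        have hch : (g' :: rest).IsChain (fun a b => s(a, b) ∈ ω' ∧ a ≠ b) := by
          have := hΔ.chain; rw [hΔeq] at this; exact (List.isChain_append.1 this).2.1
        have hclose := hΔ.closing (List.cons_ne_nil _ _)
        have hlastΔ : (p :: q :: T).getLast (List.cons_ne_nil _ _) = (g' :: rest).getLast (List.cons_ne_nil _ _) := by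
          simp only [hΔeq, List.getLast_append_of_ne_nil _ (List.cons_ne_nil g' rest)]
        have hheadΔ : (p :: q :: T).head (List.cons_ne_nil _ _) = p := rfl
        rw [hlastΔ, hheadΔ] at hclose
        -- the walk `g' :: rest ++ [p]`
        have hW : (g' :: (rest ++ [p])).IsChain (fun a b => s(a, b) ∈ ω' ∧ a ≠ b) := by
          have : g' :: (rest ++ [p]) = (g' :: rest) ++ [p] := by simp
          rw [this, List.isChain_append]
          refine ⟨hch, List.isChain_singleton _, fun x hx z hz => ?_⟩
          rw [List.getLast?_eq_some_getLast (List.cons_ne_nil g' rest), Option.mem_def, Option.some.injEq] at hx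
          simp only [List.head?_cons, Option.mem_def, Option.some.injEq] at hz
          subst hx hz; exact hclose
        -- no pair of this walk is a needle pair: each pair has a vertex of `rest` (off the needle), or is
        -- the pair `(g', p)` of the two ends of the needle, not consecutive on a needle of length ≥ 3
        have hrestN : ∀ x ∈ rest, x ∉ Ndl := by
          intro x hx hxN
          rw [hN] at hxN
          have hnd2 : ((p :: q :: N₂) ++ rest).Nodup := by
            have : p :: q :: T = (p :: q :: N₂) ++ rest := by rw [← hT]; simp
            rw [← this]; exact hΔnd
          exact (List.nodup_append.1 hnd2).2.2 x hxN x hx rfl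
        have hW' : (g' :: (rest ++ [p])).IsChain (fun a b => s(a, b) ∈ ω ∧ a ≠ b) := by
          rw [List.isChain_iff_forall_rel_of_append_cons_cons] at hW ⊢
          intro a b l₁ l₂ heq
          obtain ⟨hab, hne'⟩ := hW heq
          refine ⟨Hω _ hab fun hE => ?_, hne'⟩
          obtain ⟨haN, hbN⟩ := mem_of_mem_edgesOf hE
          cases l₁ with
          | cons c l₁' =>
            -- the pair lies inside `rest ++ [p]`: its first vertex is in `rest`, hence off the needle
            simp only [List.cons_append, List.cons.injEq] at heq
            have hnd3 : (rest ++ [p]).Nodup := by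
              have e1 : p :: q :: T = (p :: (q :: N₂)) ++ rest := by rw [← hT]; simp
              have h0 := hΔnd
              rw [e1, List.nodup_append] at h0
              rw [List.nodup_append]
              refine ⟨h0.2.1, List.nodup_singleton _, fun x hx z hz => ?_⟩
              simp only [List.mem_singleton] at hz
              subst hz
              exact fun hxz => h0.2.2 z (by simp) x hx hxz.symm
            exact hrestN a (mem_of_split_snoc hnd3 heq.2) haN
          | nil =>
            simp only [List.nil_append, List.cons.injEq] at heq
            obtain ⟨rfl, h2⟩ := heq
            cases rest with
            | cons r₀ rest' =>
              simp only [List.cons_append, List.cons.injEq] at h2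
              obtain ⟨rfl, -⟩ := h2
              exact hrestN _ List.mem_cons_self hbN
            | nil =>
              simp only [List.nil_append, List.cons.injEq] at h2
              obtain ⟨rfl, -⟩ := h2
              -- the pair `(g', p)` = (last, head) of the needle, which has length ≥ 3
              have hlen : 3 ≤ Ndl.length := by
                have : (p :: q :: T).length = Ndl.length := by rw [hN, ← hT]; simp
                omega
              have := not_mem_edgesOf_last_head hnd hlen hne
              rw [hlast, hhead] at this
              exact this hE
        have hWne : (g' :: (rest ++ [p])) ≠ [] := List.cons_ne_nil _ _
        have hsub : ∀ x ∈ g' :: (rest ++ [p]), x ∈ A := by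
          intro x hx
          apply hΔ.subset
          rw [hΔeq]
          simp only [List.mem_cons, List.mem_append, List.mem_nil_iff, or_false] at hx ⊢
          tauto
        have hconn := openConnIn_of_isChain g' (rest ++ [p]) hW' hsub
        have : (g' :: (rest ++ [p])).getLast (List.cons_ne_nil _ _) = p := by simp
        rw [this] at hconn
        exact hconn
      · -- `p` is an inner vertex: its cyclic predecessor on the circuit is its needle predecessor
        right
        refine ⟨hN₁, ?_⟩
        set ℓ := (p :: q :: T).getLast (List.cons_ne_nil _ _) with hℓ
        have hclose := hΔ.closing (List.cons_ne_nil _ _)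
        have hℓp : s(p, ℓ) ∈ ω' := by rw [Sym2.eq_swap]; exact hclose.1
        have hℓT : ℓ ∈ T := by
          rw [hℓ, List.getLast_cons (List.cons_ne_nil q T), List.getLast_cons hTne]; exact List.getLast_mem _
        have hℓq : ℓ ≠ q := fun h => hqT (h ▸ hℓT)
        rcases H p ℓ N₁ (q :: N₂) hN hN₁ (List.cons_ne_nil _ _) hℓp with ⟨l₁, l₂, h1⟩ | ⟨l₁, l₂, h1⟩
        · exact absurd (eq_of_cons_cons_eq_append hnd hN h1) hℓq
        · -- `ℓ` is the needle predecessor of `p`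
          have hN₁eq : N₁ = N₁.dropLast ++ [N₁.getLast hN₁] := (List.dropLast_append_getLast hN₁).symm
          have hℓeq : ℓ = N₁.getLast hN₁ := by
            have hN' : Ndl = N₁.dropLast ++ N₁.getLast hN₁ :: p :: (q :: N₂) := by
              rw [hN]; conv_lhs => rw [hN₁eq]; simp
            exact eq_of_cons_cons_eq_append_pred hnd hN' h1
          -- `rest ≠ []`: otherwise `ℓ` is the last vertex of the needle, which lies after `p`
          have hrest : rest ≠ [] := by
            rintro rfl
            rw [List.append_nil] at hT
            subst hT
            -- `ℓ = (p :: q :: N₂).getLast = Ndl.getLast` occurs in `N₁` too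
            have hℓlast : ℓ = Ndl.getLast hne := by
              rw [hℓ, List.getLast_congr hne (by simp) hN, List.getLast_append_of_ne_nil _ (List.cons_ne_nil _ _)]
            have hmem1 : ℓ ∈ N₁ := hℓeq ▸ List.getLast_mem hN₁
            have hmem2 : ℓ ∈ p :: q :: N₂ := by rw [hℓ]; exact List.getLast_mem _
            rw [hN] at hnd
            exact (List.nodup_append.1 hnd).2.2 ℓ hmem1 ℓ hmem2 rfl
          refine ⟨q :: N₂ ++ rest.dropLast, ?_, by simp, by rw [hN]; conv_lhs => rw [hN₁eq]; simp⟩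
          -- rotate the circuit so that it starts at `ℓ`
          have hΔeq : p :: q :: T = (p :: q :: N₂ ++ rest.dropLast) ++ [ℓ] := by
            have e1 : rest = rest.dropLast ++ [rest.getLast hrest] := (List.dropLast_append_getLast hrest).symm
            have e2 : ℓ = rest.getLast hrest := by
              rw [hℓ, List.getLast_congr _ (by simp) (show p :: q :: T = (p :: q :: N₂) ++ rest by rw [← hT]; simp),
                List.getLast_append_of_ne_nil _ hrest]
            rw [← hT, e2]; conv_lhs => rw [e1]
            simp only [List.cons_append, List.append_assoc]
          have hrot := hΔ.rotate hΔeq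
          rw [hℓeq] at hrot
          simpa using hrot
    · -- (ii) the circuit stops inside the needle: its closing pair contradicts the needle property
      exfalso
      obtain ⟨N₃, hN₂⟩ := h1
      have hN₃ : N₃ ≠ [] := by rintro rfl; exact h2 (by simpa using hN₂)
      set ℓ := (p :: q :: T).getLast (List.cons_ne_nil _ _) with hℓ
      have hclose := hΔ.closing (List.cons_ne_nil _ _)
      have hℓT : ℓ ∈ T := by
        rw [hℓ, List.getLast_cons (List.cons_ne_nil q T), List.getLast_cons hTne]; exact List.getLast_mem _
      have hTeq : T = T.dropLast ++ [ℓ] := by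
        rw [hℓ, List.getLast_cons (List.cons_ne_nil q T), List.getLast_cons hTne]
        exact (List.dropLast_append_getLast hTne).symm
      -- `ℓ` is an inner vertex of the needle
      have hNℓ : Ndl = (N₁ ++ p :: q :: T.dropLast) ++ ℓ :: N₃ := by
        rw [hN, ← hN₂]; conv_lhs => rw [hTeq]
        simp only [List.cons_append, List.append_assoc, List.nil_append]
      rcases H ℓ p (N₁ ++ p :: q :: T.dropLast) N₃ hNℓ (by simp) hN₃ hclose.1 with ⟨l₁, l₂, h3⟩ | ⟨l₁, l₂, h3⟩
      · -- `p` would be the needle successor of `ℓ`, i.e. the head of `N₃`; but `p` occurs before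
        obtain ⟨d, N₃', rfl⟩ := List.exists_cons_of_ne_nil hN₃
        have hpd : p = d := (eq_of_cons_cons_eq_append hnd hNℓ h3).symm ▸ rfl
        have := not_mem_of_nodup_split (M := q :: N₂) hnd hN
        apply this.1
        rw [← hN₂, hpd]; simp
      · -- `ℓ` would be the needle successor of `p`, i.e. `q`
        have hℓq : ℓ = q := eq_of_cons_cons_eq_append hnd hN h3
        exact hqT (hℓq ▸ hℓT)
  -- induction on the length of `N₁`
  intro n
  induction n with
  | zero =>
    intro N₁ hlen p q N₂ T hN hΔ h3
    have : N₁ = [] := List.eq_nil_of_length_eq_zero (Nat.le_zero.1 hlen)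
    subst this
    rcases step [] p q N₂ T hN hΔ h3 with h | ⟨hN₁, -⟩
    · exact h
    · exact absurd rfl hN₁
  | succ n ih =>
    intro N₁ hlen p q N₂ T hN hΔ h3
    rcases step N₁ p q N₂ T hN hΔ h3 with h | ⟨hN₁, T', hΔ', h3', hN'⟩
    · exact h
    · exact ih N₁.dropLast (by rw [List.length_dropLast]; omega) _ _ _ _ hN' hΔ' h3'

end NeedleCircuit

end NTW17

end Literature.Probability.Percolation

end
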